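import Summits.BirchSwinnertonDyer.Rank1Residual.X12.CMGoodOddPrimeAnyConductor
import Summits.BirchSwinnertonDyer.Rank1Residual.X12.CMRamifiedAdditive
import Literature.NumberTheory.EllipticCurves.NeronComponentDataProofs
import Literature.NumberTheory.EllipticCurves.OggFormulaTameTypesTwoProofs
import Literature.NumberTheory.EllipticCurves.ShafarevichGoodReductionBadPlacesProofs
import Literature.NumberTheory.EllipticCurves.RootNumberTwistProofs
import Literature.NumberTheory.DiophantineGeometry.TateAlgorithmAdditiveProofs
import Literature.NumberTheory.DiophantineGeometry.TateAlgorithmOrdDiscriminant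
import HarnessLib

/-!
# CM by a field other than `ℚ(√−3)`: `3` never divides a Tamagawa number away from `3`; hence at a
# GOOD `p = 3` the class Tamagawa datum of route T-KR3G is a THEOREM, and for every CM curve of
# analytic rank one with good reduction at `3`, `BSD(E,3) ⟺` the curve's own lower half

HONEST FRAMING (cell `b2b-bsdres`, run/shared/lean/b2b/bsd-rank1-residual/, verbatim in every
file): the goal of the cell is to DELETE the COMBINATION-SHAPED residual classes of the
Birch–Swinnerton-Dyer formula for ALL analytic-rank `≤ 1` elliptic curves over `ℚ` — "full BSD
formula for every rank `≤ 1` curve in class `C`" assembled STRICTLY from published theorems — so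
that the rank-`≤ 1` remainder becomes exactly the CONSTRUCTION-SHAPED classes, which are TYPED
(missing-input `Prop`s), NOT attempted. This is not "finishing BSD". Unit `b2b-bsdres-x1b` (X12
prover owner), generation 22; research route, no claim beyond the stated class; X12 REMAINS
CONSTRUCTION-SHAPED; nothing is booked here — booking is the lane's and the referee's.

Theorems only; no definition, no new named fact.

`CMGoodOddPrime.lean` / `CMGoodOddPrimeAnyConductor.lean` (gen 21, route T-KR3G) prove, for a CM
curve of analytic rank one at a GOOD odd prime `p` unramified in the CM field, the upper half of
`BSD(E,p)` for EVERY curve — modulo, at `p = 3` only, the CLASS TAMAGAWA DATUM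
`∀ E' ∼ E, 3 ∤ ∏_ℓ c_ℓ(E')` (a two-engine table column on the 225 `T-KOB13@3`-held classes; at
`p ≥ 5` it is the theorem `not_dvd_tamagawaProduct_of_hasCM`, since every `c_ℓ ≤ 4`).

This file DISCHARGES that datum: **for a CM curve over `ℚ` whose CM field is not `ℚ(√−3)`, the
prime `3` divides no local Tamagawa number `c_ℓ`, `ℓ ≠ 3`** (§1), by an elementary Kodaira–Néron
argument entirely inside the tree's proved local theory:

* `c_ℓ = #Φ_ℓ(𝔽_ℓ)` divides `#Φ_ℓ(𝔽̄_ℓ)`, the component-group order of the Kodaira symbol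
  (`localTamagawaNumber_dvd_componentGroupOrder`, `nonempty_neronComponentData_holds`), which is
  divisible by `3` only for the types `Iₙ` (`3 ∣ n`), `IV`, `IV*` (Silverman *ATAEC* Table 4.1);
* a CM curve has no multiplicative place (`not_hasMultiplicativeReductionAtPrime_of_hasCM`,
  *ATAEC* II.6.4), so `Iₙ` is excluded (`kodairaSymbolAt_eq_I_iff_holds`);
* types `IV`, `IV*` force `ord_ℓ Δ_min = 4`, `8`: at `ℓ ≥ 5` by Ogg's formula in the tame case,
  `ord_ℓ Δ_min = m_ℓ + 1` (`ordMinimalDiscriminant_eq_numComponentsAt_add_one_holds`, *ATAEC*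
  IV.11.1 / Table 4.1), and at `ℓ = 2` by Tate's algorithm with `π = 2`
  (`ordMinimalDiscriminant_eq_of_kodairaSymbolAt_IV_two / _IVstar_two`, *ATAEC* IV.9.4 Steps 5, 8);
* but the ten CM `j`-invariants with `d_K ≠ −3` are PERFECT CUBES (`1728 = 12³`, `287496 = 66³`,
  `−3375 = (−15)³`, `16581375 = 255³`, `8000 = 20³`, `−32768 = (−32)³`, `−884736 = (−96)³`,
  `−884736000 = (−960)³`, `−147197952000 = (−5280)³`, `−262537412640768000 = (−640320)³`;
  Weber: `γ₂ = j^{1/3} ∈ ℚ(j)` when `3 ∤ d_K`), so `Δ = (c₄/j^{1/3})³` is a cube and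
  `3 ∣ ord_ℓ Δ_min` at every place — contradiction. (`HasCM ⟺ j ∈ cmJInvariants` is the tree's
  THEOREM `hasCM_iff_j_mem_holds`, Heegner–Stark included.)

§2 feeds §1 into gen 21's §2–§3 of `CMGoodOddPrimeAnyConductor.lean` (the place `ℓ = 3` being good
by hypothesis there): **for every globally minimal CM curve `E/ℚ` of analytic rank one with good
reduction at `3`** (then `K ≠ ℚ(√−3)`, `not_cmRamified_of_hasCM_of_good`):
`MissingUpperBoundAt E 3` outright, `BSD(E,3) ⟺ MissingLowerBoundAt E 3`, and **route T-KR3G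
with NO datum at all**: `BSD(E,3)` from `r_an = 1` and a certified `3`-adic unit `#Ш(E)_an` ALONE
(`bsdp_three_of_hasCM_rankOne_of_good_of_shaAn_unit`); uniformly in every GOOD ODD `p`
(`bsdp_iff_missingLowerBoundAt_of_hasCM_rankOne_of_good_odd'`): the partition's whole corner
"CM, `r_an = 1`, odd good `p`" (rows C9/C10; at `p = 3` inert the `T-KOB13@3` hold, routed to
Kobayashi 2013 Cor. 1.4, primary unread) has residue EXACTLY the curve's own lower half, from read
primaries and with no binder but published named facts and the cell predicates.

Not claimed: `p = 2`; `p` ramified in the CM field; the place `ℓ = 3` when `3 ∣ N` (types `IV/IV*`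
at a wild `3` are not excluded by `ord Δ` alone — the inert-BAD-at-`3` family keeps its datum);
the lower half itself. X12 REMAINS CONSTRUCTION-SHAPED.

References: [SilvermanATAEC1994] Cor. IV.9.2, Thm. IV.9.4 (Steps 2, 5, 8) and Table 4.1, IV.11.1,
Thm. II.6.4, App. A §3; [SilvermanAEC2009] VII.1 Prop. 1.3, VII.5 Prop. 5.1, App. C §11;
[Mazur1978] Cor. 4.1; [FriedbergHoffstein1995] Thm. B; [MatarNekovar2019] Thm. 0.3, §0.11;
[BurungaleFlach2024] Thm. 1.1 / Cor. 2; [Miller2011LMS] Def. 1.1; HOME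
`b2b-bsdres-x1b/X12-ROUTE.md` §26.
-/

noncomputable section

open scoped Classical NumberField

open WeierstrassCurve NumberField IsDedekindDomain IsDedekindDomain.HeightOneSpectrum
  Rat.HeightOneSpectrum Literature.NumberTheory.EllipticCurves
  Literature.NumberTheory.EllipticCurves.ModularForms
  Literature.NumberTheory.EllipticCurves.Rank1Residual
  Literature.NumberTheory.EllipticCurves.Rank1Residual.Typed
  Literature.NumberTheory.Automorphic
  Literature.NumberTheory.DiophantineGeometry

namespace Summit.BirchSwinnertonDyer.Rank1Residual.X12

/-! ### §0 Arithmetic of the Kodaira symbol and of a cube discriminant -/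

/-- `3` divides the component-group order `#Φ(k̄)` of a Kodaira symbol only for `Iₙ` with `3 ∣ n`,
`n ≠ 0`, and for the types `IV`, `IV*` (Silverman *ATAEC* Table 4.1: the orders are
`n, 1, 2, 3, 4, 3, 2, 1`). [cite: SilvermanATAEC1994, Table 4.1 (p. 365)] -/
theorem kodairaSymbol_of_three_dvd_componentGroupOrder {T : KodairaSymbol}
    (h : 3 ∣ T.componentGroupOrder) :
    (∃ n, n ≠ 0 ∧ T = .I n) ∨ T = .IV ∨ T = .IVstar := by
  rcases T with n | _ | _ | _ | n | _ | _ | _ <;>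
    simp only [KodairaSymbol.componentGroupOrder] at h
  · refine Or.inl ⟨n, ?_, rfl⟩
    rintro rfl
    simp at h
  all_goals first | omega | simp

/-- A `j`-invariant that is the cube of a non-zero rational makes the discriminant of the equation a
cube: `c₄³ = j·Δ`, so `Δ = (c₄/t)³` when `j = t³`. [cite: SilvermanAEC2009, III.1 (c₄³ = jΔ)] -/
theorem exists_Δ_eq_cube_of_j_eq_cube (W : WeierstrassCurve ℚ) [W.IsElliptic] {t : ℚ} (ht : t ≠ 0)
    (hj : W.j = t ^ 3) : ∃ s : ℚ, W.Δ = s ^ 3 := by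
  refine ⟨W.c₄ / t, ?_⟩
  have h : W.c₄ ^ 3 = W.Δ * t ^ 3 := by
    have h' := hj
    rw [j, Units.inv_mul_eq_iff_eq_mul, coe_Δ'] at h'
    exact h'
  rw [div_pow, h]
  field_simp

/-- **The ten CM `j`-invariants whose CM field is not `ℚ(√−3)` are perfect cubes** (Weber's
`γ₂ = j^{1/3} ∈ ℚ(j)` for `3 ∤ d_K`; here by inspection of Silverman *ATAEC* App. A §3:
`12³, 66³, (−15)³, 255³, 20³, (−32)³, (−96)³, (−960)³, (−5280)³, (−640320)³`), `HasCM ⟺ j ∈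
cmJInvariants` being the tree theorem `hasCM_iff_j_mem_holds`; `d_K = −3` is excluded by
`¬ CMRamified W 3`. [cite: SilvermanATAEC1994, App. A §3 (table of CM j-invariants)] -/
theorem exists_j_eq_cube_of_hasCM_of_not_cmRamified_three (W : WeierstrassCurve ℚ) [W.IsElliptic]
    (hCM : W.HasCM) (hnr : ¬ CMRamified W 3) : ∃ t : ℚ, t ≠ 0 ∧ W.j = t ^ 3 := by
  have hj : W.j ∈ cmJInvariants := (hasCM_iff_j_mem_holds W).mp hCM
  have hram : ∀ {j₀ : ℚ}, W.j = j₀ → cmFieldDiscrOfJ j₀ = -3 → False := fun h hd ↦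
    hnr (by unfold CMRamified; rw [h, hd]; norm_num)
  simp only [cmJInvariants, Finset.mem_insert, Finset.mem_singleton] at hj
  rcases hj with h | h | h | h | h | h | h | h | h | h | h | h | h
  · exact (hram h (by norm_num [cmFieldDiscrOfJ])).elim
  · exact ⟨12, by norm_num, by rw [h]; norm_num⟩
  · exact ⟨-15, by norm_num, by rw [h]; norm_num⟩
  · exact ⟨20, by norm_num, by rw [h]; norm_num⟩
  · exact ⟨-32, by norm_num, by rw [h]; norm_num⟩
  · exact (hram h (by norm_num [cmFieldDiscrOfJ])).elim
  · exact ⟨66, by norm_num, by rw [h]; norm_num⟩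
  · exact ⟨-96, by norm_num, by rw [h]; norm_num⟩
  · exact (hram h (by norm_num [cmFieldDiscrOfJ])).elim
  · exact ⟨255, by norm_num, by rw [h]; norm_num⟩
  · exact ⟨-960, by norm_num, by rw [h]; norm_num⟩
  · exact ⟨-5280, by norm_num, by rw [h]; norm_num⟩
  · exact ⟨-640320, by norm_num, by rw [h]; norm_num⟩

/-- **A cube discriminant has `3 ∣ ord_v Δ_min` at every finite place** (globally minimal
equation: `Δ = Δ_min`, Silverman *AEC* VII.1 Prop. 1.3 / VIII.8; `valuation_Δ_eq_of_isMinimalAt_holds`).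
[cite: SilvermanAEC2009, VII.1 Prop. 1.3 and VIII.8 (global minimal equations)] -/
theorem three_dvd_ordMinimalDiscriminant_of_Δ_eq_cube (W : WeierstrassCurve ℚ) [W.IsElliptic]
    [W.IsGloballyMinimal] {s : ℚ} (hΔ : W.Δ = s ^ 3) (v : HeightOneSpectrum (𝓞 ℚ)) :
    3 ∣ W.ordMinimalDiscriminant v := by
  have hval := valuation_Δ_eq_of_isMinimalAt_holds (v := v) (W := W)
    (IsGloballyMinimal.isMinimalAt W v)
  rw [hΔ, map_pow] at hval
  have hlog := congrArg WithZero.log hval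
  rw [WithZero.log_pow, WithZero.log_exp] at hlog
  have h3 : (3 : ℤ) ∣ (W.ordMinimalDiscriminant v : ℤ) :=
    ⟨-WithZero.log (v.valuation ℚ s), by rw [nsmul_eq_mul] at hlog; push_cast at hlog; omega⟩
  exact_mod_cast h3

/-! ### §1 `3 ∤ c_ℓ` away from `ℓ = 3` for a curve with cube discriminant and no multiplicative place -/

/-- **Local form.** Let `W/ℚ` be globally minimal with `Δ` a cube, `v` a finite place at which `W`
is not multiplicative, and either `v ∤ 3` or `W` good at `v`. Then `3 ∤ c_v`. Kodaira–Néron: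
`c_v ∣ #Φ_v(k̄_v)`, which is divisible by `3` only for `Iₙ` (`3 ∣ n`; multiplicative), `IV`, `IV*`;
the latter two have `ord_v Δ_min = 4, 8` (Ogg's formula, tame case, at residue characteristic
`≥ 5`; Tate's algorithm Steps 5 and 8 with `π = 2` at `v ∣ 2`), against `3 ∣ ord_v Δ_min`.
[cite: SilvermanATAEC1994, Cor. IV.9.2 (c),(d), IV.9.4 Steps 2, 5, 8, Table 4.1 and IV.11.1] -/
theorem not_three_dvd_localTamagawaNumber_of_Δ_eq_cube (W : WeierstrassCurve ℚ) [W.IsElliptic]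
    [W.IsGloballyMinimal] {s : ℚ} (hΔ : W.Δ = s ^ 3) (v : HeightOneSpectrum (𝓞 ℚ))
    (hmult : ¬ W.HasMultiplicativeReductionAt v)
    (h3 : (primesEquiv v : ℕ) = 3 → W.HasGoodReductionAt v) :
    ¬ 3 ∣ (W.baseChange (v.adicCompletion ℚ)).localTamagawaNumber (v.adicCompletionIntegers ℚ) := by
  haveI : Finite (IsLocalRing.ResidueField (v.adicCompletionIntegers ℚ)) :=
    HeightOneSpectrum.finite_residueField_adicCompletionIntegers ℚ v
  haveI : PerfectField (IsLocalRing.ResidueField (v.adicCompletionIntegers ℚ)) :=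
    PerfectField.ofFinite
  intro hdvd
  have hord : 3 ∣ W.ordMinimalDiscriminant v := three_dvd_ordMinimalDiscriminant_of_Δ_eq_cube W hΔ v
  have hcgo : 3 ∣ (W.kodairaSymbolAt v).componentGroupOrder :=
    hdvd.trans (localTamagawaNumber_dvd_componentGroupOrder v W (nonempty_neronComponentData_holds W v))
  -- residue characteristic of `v`
  have hp : (primesEquiv v : ℕ).Prime := (primesEquiv v).2
  have hchar := X2.ringChar_quot_asIdeal_eq_primesEquiv v
  -- the additive types `IV`, `IV*` force `ord_v Δ_min ∈ {4, 8}`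
  have hIV : ∀ {T : KodairaSymbol}, W.kodairaSymbolAt v = T → T.IsAdditive → (T = .IV ∨ T = .IVstar) →
      False := by
    intro T hk hTadd hT
    have hadd : W.HasAdditiveReductionAt v :=
      (isAdditive_kodairaSymbolAt_iff_holds v W).mp (hk ▸ hTadd)
    have hm : T.numComponents = 3 ∨ T.numComponents = 7 := by
      rcases hT with rfl | rfl <;> simp [KodairaSymbol.numComponents]
    by_cases h2 : (primesEquiv v : ℕ) = 2
    · -- `v ∣ 2`: Tate's algorithm with `π = 2`
      have hv2 : (2 : 𝓞 ℚ) ∈ v.asIdeal := by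
        have h := (natCast_mem_asIdeal_iff_eq_primesEquiv_symm v Nat.prime_two).mpr
          (by rw [Equiv.eq_symm_apply]; exact Subtype.ext h2)
        exact_mod_cast h
      rcases hT with rfl | rfl
      · have h4 := (W.ordMinimalDiscriminant_eq_of_kodairaSymbolAt_IV_two hv2 hk).1
        omega
      · have h8 := (W.ordMinimalDiscriminant_eq_of_kodairaSymbolAt_IVstar_two hv2 hk).1
        omega
    by_cases h3' : (primesEquiv v : ℕ) = 3
    · -- `v ∣ 3`: good reduction by hypothesis, not additive
      exact (h3 h3').not_hasAdditiveReductionAt hadd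
    · -- residue characteristic `≥ 5`: Ogg's formula, tame case
      have hc2 : ringChar (𝓞 ℚ ⧸ v.asIdeal) ≠ 2 := by rw [hchar]; exact h2
      have hc3 : ringChar (𝓞 ℚ ⧸ v.asIdeal) ≠ 3 := by rw [hchar]; exact h3'
      have hOgg := ordMinimalDiscriminant_eq_numComponentsAt_add_one_holds v W hadd hc2 hc3
      change W.ordMinimalDiscriminant v = (W.kodairaSymbolAt v).numComponents + 1 at hOgg
      rw [hk] at hOgg
      omega
  rcases kodairaSymbol_of_three_dvd_componentGroupOrder hcgo with ⟨n, hn, hk⟩ | hk | hk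
  · -- `Iₙ`, `n ≠ 0`: multiplicative, excluded
    exact hmult ((kodairaSymbolAt_eq_I_iff_holds v W hn).mp hk).1
  · exact hIV hk (by decide) (Or.inl rfl)
  · exact hIV hk (by decide) (Or.inr rfl)

/-- A prime dividing a `finprod` of natural numbers divides one of the factors. [folklore] -/
private theorem exists_dvd_of_prime_dvd_finprod {ι : Type*} {f : ι → ℕ} {p : ℕ} (hp : p.Prime)
    (h : p ∣ ∏ᶠ i, f i) : ∃ i, p ∣ f i := by
  by_cases hfin : (Function.mulSupport f).Finite
  · rw [finprod_eq_prod f hfin] at h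
    obtain ⟨i, -, hi⟩ := (Nat.Prime.prime hp).exists_mem_finset_dvd h
    exact ⟨i, hi⟩
  · rw [finprod_of_infinite_mulSupport hfin] at h
    exact absurd (Nat.le_of_dvd one_pos h) (by have := hp.two_le; omega)

/-- **Global form: `3 ∤ ∏_ℓ c_ℓ(E)`** for a globally minimal `W/ℚ` with cube discriminant, no
multiplicative place, and good reduction at `3`. [cite: SilvermanATAEC1994, Cor. IV.9.2 (c),(d), Table 4.1 and IV.11.1] -/
theorem not_three_dvd_tamagawaProduct_of_Δ_eq_cube (W : WeierstrassCurve ℚ) [W.IsElliptic]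
    [W.IsGloballyMinimal] {s : ℚ} (hΔ : W.Δ = s ^ 3)
    (hmult : ∀ v : HeightOneSpectrum (𝓞 ℚ), ¬ W.HasMultiplicativeReductionAt v)
    [Fact (3 : ℕ).Prime] (hgood : Good W 3) : ¬ 3 ∣ W.tamagawaProduct := by
  intro hdvd
  unfold WeierstrassCurve.tamagawaProduct at hdvd
  obtain ⟨v, hv⟩ := exists_dvd_of_prime_dvd_finprod Nat.prime_three hdvd
  refine not_three_dvd_localTamagawaNumber_of_Δ_eq_cube W hΔ v (hmult v) (fun h3 ↦ ?_) hv
  rw [← hasGoodReductionAtPrime_iff_hasGoodReductionAt_ringOfIntegers v W]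
  convert hgood

/-- **CM by a field other than `ℚ(√−3)`, good reduction at `3`: `3 ∤ ∏_ℓ c_ℓ(E)`.** For a
globally minimal CM curve `W/ℚ` with good reduction at `3` (so `3 ∤ d_K`,
`not_cmRamified_of_hasCM_of_good`; `j` is a cube; no multiplicative place, *ATAEC* II.6.4).
This is the class Tamagawa datum of route T-KR3G (`CMGoodOddPrime*.lean` §2) as a THEOREM.
[cite: SilvermanATAEC1994, Cor. IV.9.2, Table 4.1, IV.11.1, Thm. II.6.4 and App. A §3] -/
theorem not_three_dvd_tamagawaProduct_of_hasCM_of_good_three (W : WeierstrassCurve ℚ) [W.IsElliptic]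
    [W.IsGloballyMinimal] [Fact (3 : ℕ).Prime] (hCM : W.HasCM) (hgood : Good W 3) :
    ¬ 3 ∣ W.tamagawaProduct := by
  have hnr : ¬ CMRamified W 3 := not_cmRamified_of_hasCM_of_good W 3 hCM (by decide) hgood
  obtain ⟨t, ht, hj⟩ := exists_j_eq_cube_of_hasCM_of_not_cmRamified_three W hCM hnr
  obtain ⟨s, hs⟩ := exists_Δ_eq_cube_of_j_eq_cube W ht hj
  refine not_three_dvd_tamagawaProduct_of_Δ_eq_cube W hs (fun v hm ↦ ?_) hgood
  haveI := Fact.mk (primesEquiv v).2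
  exact W.not_hasMultiplicativeReductionAtPrime_of_hasCM hCM (primesEquiv v : ℕ)
    ((W.hasMultiplicativeReductionAtPrime_iff_hasMultiplicativeReductionAt_ringOfIntegers v).mpr hm)

/-- **The class Tamagawa datum of route T-KR3G at `p = 3`, discharged**: every globally minimal
`W' ∼ W` of a CM curve `W` with good reduction at `3` has `3 ∤ ∏_ℓ c_ℓ(W')` (CM and good reduction
at `3` are `ℚ`-isogeny invariants: `hasCM_of_isIsogenous`, Silverman *AEC* Cor. VII.7.2).
[cite: SilvermanAEC2009, Cor. VII.7.2] [cite: SilvermanATAEC1994, Cor. IV.9.2, Table 4.1 and IV.11.1] -/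
theorem not_three_dvd_tamagawaProduct_of_isIsogenous_of_hasCM_of_good_three (W : WeierstrassCurve ℚ)
    [W.IsElliptic] [Fact (3 : ℕ).Prime] (hCM : W.HasCM) (hgood : Good W 3)
    (W' : WeierstrassCurve ℚ) [W'.IsElliptic] [W'.IsGloballyMinimal] (hiso : IsIsogenous W W') :
    ¬ 3 ∣ W'.tamagawaProduct := by
  refine not_three_dvd_tamagawaProduct_of_hasCM_of_good_three W' (hasCM_of_isIsogenous hiso hCM) ?_
  obtain ⟨v, hv⟩ : ∃ v : HeightOneSpectrum (𝓞 ℚ), (primesEquiv v : ℕ) = 3 :=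
    ⟨primesEquiv.symm ⟨3, Nat.prime_three⟩, by rw [Equiv.apply_symm_apply]⟩
  have hg : W.HasGoodReductionAt v := by
    rw [← hasGoodReductionAtPrime_iff_hasGoodReductionAt_ringOfIntegers v W]
    convert hgood
  have hg' : W'.HasGoodReductionAt v := (hiso.hasGoodReductionAt_iff_of_isIsogenous v).mp hg
  have h := (hasGoodReductionAtPrime_iff_hasGoodReductionAt_ringOfIntegers v W').mpr hg'
  convert h
  exact hv.symm

/-! ### §2 CM, analytic rank one, GOOD reduction at `3`: EVERY curve, NO datum -/

variable
  (hGZ : ∀ (N : ℕ) [NeZero N] (W : WeierstrassCurve ℚ) (K : Type) [Field K] [NumberField K],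
    gross_zagier N W K)
  (hKo : ∀ (N : ℕ) [NeZero N] (W : WeierstrassCurve ℚ) (K : Type) [Field K] [NumberField K],
    kolyvagin N W K)
  (hMN : ∀ (N : ℕ) [NeZero N] (W : WeierstrassCurve ℚ) (K : Type) [Field K] [NumberField K],
    MatarNekovar2019.thm03_padicValNat_card_sha_le_of_irreducible N W K)
  (hGZK : rank_eq_analyticRank_of_analyticRank_le_one) (hmod : hasEntireLFunction_rat)
  (hnf : exists_isNewformOf)
  (hFH2 : friedbergHoffstein_exists_heegnerField_splitDivisors_twist_ne_zero)
  (hCM8 : bsdTriple_of_hasCM_of_L_one_ne_zero)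
  (hMazur : mazur_not_dvd_maninConstant_of_odd) (hCassels : bsdRHS_eq_of_isIsogenous)

include hGZ hKo hMN hGZK hmod hnf hFH2 hCM8 hMazur hCassels

/-- **CM, ANALYTIC RANK ONE, GOOD REDUCTION AT `3` — EVERY CURVE, NO DATUM: the UPPER half of
`BSD(E,3)` from published facts only.** `missingUpperBoundAt_of_hasCM_rankOne_of_good_odd` (gen 21:
Mazur's Cor. 4.1 on the modularity-supplied optimal member, Kolyvagin–Matar–Nekovář over a
Friedberg–Hoffstein field split at `2` and `3`, Rubin/Burungale–Flach for the rank-zero CM twist,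
Cassels) with its class Tamagawa datum supplied by
`not_three_dvd_tamagawaProduct_of_isIsogenous_of_hasCM_of_good_three`; `3 ∤ d_K` is automatic
(`not_cmRamified_of_hasCM_of_good`). [cite: Mazur1978, Cor. 4.1] [cite: FriedbergHoffstein1995, Thm. B]
[cite: MatarNekovar2019, Thm. 0.3 and §0.11] [cite: BurungaleFlach2024, Thm. 1.1 and Cor. 2]
[cite: SilvermanATAEC1994, Cor. IV.9.2, Table 4.1 and IV.11.1] -/
theorem missingUpperBoundAt_of_hasCM_rankOne_of_good_three
    (W : WeierstrassCurve ℚ) [W.IsElliptic] [W.IsGloballyMinimal] [Fact (3 : ℕ).Prime]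
    (hCM : W.HasCM) (hr : W.analyticRank = 1) (hgood : Good W 3) : MissingUpperBoundAt W 3 :=
  missingUpperBoundAt_of_hasCM_rankOne_of_good_odd hGZ hKo hMN hGZK hmod hnf hFH2 hCM8 hMazur hCassels
    W 3 hCM hr (by decide) hgood (not_cmRamified_of_hasCM_of_good W 3 hCM (by decide) hgood)
    (fun W' _ _ hiso ↦ not_three_dvd_tamagawaProduct_of_isIsogenous_of_hasCM_of_good_three W hCM hgood
      W' hiso)

/-- **For every such curve `BSD(E,3) ⟺ MissingLowerBoundAt W 3`**: at `p = 3` of good reduction the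
residue of a CM curve of analytic rank one is EXACTLY its own lower (main-conjecture) half — no
table datum, no binder but published named facts and the cell predicates.
[cite: Mazur1978, Cor. 4.1] [cite: MatarNekovar2019, Thm. 0.3 and §0.11] [cite: Miller2011LMS, §1 and Def. 1.1] -/
theorem bsdp_iff_missingLowerBoundAt_of_hasCM_rankOne_of_good_three
    (W : WeierstrassCurve ℚ) [W.IsElliptic] [W.IsGloballyMinimal] [Fact (3 : ℕ).Prime]
    (hCM : W.HasCM) (hr : W.analyticRank = 1) (hgood : Good W 3) :
    BSDp W 3 ↔ MissingLowerBoundAt W 3 :=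
  bsdp_iff_missingLowerBoundAt_of_hasCM_rankOne_of_good_odd hGZ hKo hMN hGZK hmod hnf hFH2 hCM8 hMazur
    hCassels W 3 hCM hr (by decide) hgood (not_cmRamified_of_hasCM_of_good W 3 hCM (by decide) hgood)
    (fun W' _ _ hiso ↦ not_three_dvd_tamagawaProduct_of_isIsogenous_of_hasCM_of_good_three W hCM hgood
      W' hiso)

/-- **The cell's typed input `X12.MissingInputAt W 3` follows from the curve's own lower half** for
every CM curve of analytic rank one with good reduction at `3` (the `T-KOB13@3` corner, and the
split-good corner). [cite: Mazur1978, Cor. 4.1] [cite: MatarNekovar2019, Thm. 0.3 and §0.11] -/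
theorem missingInputAt_three_of_hasCM_rankOne_of_good_of_lower
    (W : WeierstrassCurve ℚ) [W.IsElliptic] [W.IsGloballyMinimal] [Fact (3 : ℕ).Prime]
    (hCM : W.HasCM) (hr : W.analyticRank = 1) (hgood : Good W 3) (hlow : MissingLowerBoundAt W 3) :
    X12.MissingInputAt W 3 :=
  missingInputAt_of_hasCM_rankOne_of_good_odd_of_lower hGZ hKo hMN hGZK hmod hnf hFH2 hCM8 hMazur
    hCassels W 3 hCM hr (by decide) hgood (not_cmRamified_of_hasCM_of_good W 3 hCM (by decide) hgood)
    (fun W' _ _ hiso ↦ not_three_dvd_tamagawaProduct_of_isIsogenous_of_hasCM_of_good_three W hCM hgood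
      W' hiso) hlow

/-- **ROUTE T-KR3G WITH NO DATUM — `BSD(E,3)` for EVERY CM curve of analytic rank one with good
reduction at `3`, from `r_an = 1` and a certified `3`-adic unit `#Ш(E)_an = q` ALONE.** No Iwasawa
theory at `3`, no `3`-adic height, no Heegner index, no descent, no Manin table, no optimality, no
Tamagawa table, no parity of the conductor: an independent second basis, resting on read primaries,
for the whole `T-KOB13@3` hold (225 classes `N < 5·10⁵`, every member rank `1` with `#Ш_an = 1` in
two engines) and for every curve of the corner at any conductor. [cite: Mazur1978, Cor. 4.1]
[cite: FriedbergHoffstein1995, Thm. B] [cite: MatarNekovar2019, Thm. 0.3 and §0.11]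
[cite: BurungaleFlach2024, Thm. 1.1 and Cor. 2] [cite: Miller2011LMS, §1 and Def. 1.1] -/
theorem bsdp_three_of_hasCM_rankOne_of_good_of_shaAn_unit
    (W : WeierstrassCurve ℚ) [W.IsElliptic] [W.IsGloballyMinimal] [Fact (3 : ℕ).Prime]
    (hCM : W.HasCM) (hr : W.analyticRank = 1) (hgood : Good W 3)
    {q : ℚ} (hq : shaAn W = (q : ℂ)) (hv : padicValRat 3 q = 0) : BSDp W 3 :=
  (bsdp_iff_missingLowerBoundAt_of_hasCM_rankOne_of_good_three hGZ hKo hMN hGZK hmod hnf hFH2 hCM8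
    hMazur hCassels W hCM hr hgood).mpr (missingLowerBoundAt_of_shaAn_unit hq hv)

/-- **CM, analytic rank one, ANY GOOD ODD `p` — EVERY curve, NO datum: `BSD(E,p) ⟺
MissingLowerBoundAt W p`.** Uniform form of gen 21's §3 (`p ≥ 5`, class Tamagawa datum automatic by
`c_ℓ ≤ 4`) and of this file's `p = 3`; `p ∤ d_K` is automatic at a good odd `p`
(`not_cmRamified_of_hasCM_of_good`). The partition's whole corner "CM, `r_an = 1`, odd GOOD `p`"
(split: Rubin/Li–Liu–Tian; inert: Kobayashi 2013 Cor. 1.4, `p = 3` included, primary unread) thus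
has residue EXACTLY the curve's own lower half, from read primaries.
[cite: Mazur1978, Cor. 4.1] [cite: FriedbergHoffstein1995, Thm. B] [cite: MatarNekovar2019, Thm. 0.3 and §0.11]
[cite: SilvermanATAEC1994, Cor. IV.9.2 (d), Table 4.1 and IV.11.1] -/
theorem bsdp_iff_missingLowerBoundAt_of_hasCM_rankOne_of_good_odd'
    (W : WeierstrassCurve ℚ) [W.IsElliptic] [W.IsGloballyMinimal] (p : ℕ) [Fact p.Prime]
    (hCM : W.HasCM) (hr : W.analyticRank = 1) (hp2 : p ≠ 2) (hgood : Good W p) :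
    BSDp W p ↔ MissingLowerBoundAt W p := by
  have hnr : ¬ CMRamified W p := not_cmRamified_of_hasCM_of_good W p hCM hp2 hgood
  by_cases hp3 : p = 3
  · subst hp3
    exact bsdp_iff_missingLowerBoundAt_of_hasCM_rankOne_of_good_three hGZ hKo hMN hGZK hmod hnf hFH2
      hCM8 hMazur hCassels W hCM hr hgood
  · have hp5 : 5 ≤ p := (Fact.out : p.Prime).five_le_of_ne_two_of_ne_three hp2 hp3
    exact bsdp_iff_missingLowerBoundAt_of_hasCM_rankOne_of_good_of_five_le hGZ hKo hMN hGZK hmod hnf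
      hFH2 hCM8 hMazur hCassels W p hCM hr hp5 hgood hnr

/-- **Route T-KR at ANY good odd `p` for EVERY CM curve of analytic rank one, any conductor:
`BSD(E,p)` from `r_an = 1` and a certified `p`-adic unit `#Ш(E)_an` ALONE** (`p = 3` included).
[cite: Mazur1978, Cor. 4.1] [cite: FriedbergHoffstein1995, Thm. B] [cite: MatarNekovar2019, Thm. 0.3 and §0.11]
[cite: BurungaleFlach2024, Thm. 1.1 and Cor. 2] [cite: Miller2011LMS, §1 and Def. 1.1] -/
theorem bsdp_of_hasCM_rankOne_of_good_odd_of_shaAn_unit'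
    (W : WeierstrassCurve ℚ) [W.IsElliptic] [W.IsGloballyMinimal] (p : ℕ) [Fact p.Prime]
    (hCM : W.HasCM) (hr : W.analyticRank = 1) (hp2 : p ≠ 2) (hgood : Good W p)
    {q : ℚ} (hq : shaAn W = (q : ℂ)) (hv : padicValRat p q = 0) : BSDp W p :=
  (bsdp_iff_missingLowerBoundAt_of_hasCM_rankOne_of_good_odd' hGZ hKo hMN hGZK hmod hnf hFH2 hCM8
    hMazur hCassels W p hCM hr hp2 hgood).mpr (missingLowerBoundAt_of_shaAn_unit hq hv)

/-- **On class X12 at a good odd prime** (inside `ClassX12 W p`, `p` odd and good leaves exactly the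
corner "`p = 3` not split in `K`", i.e. the `T-KOB13@3` cells): `BSD(E,p) ⟺ MissingLowerBoundAt W p`,
no datum. [cite: Mazur1978, Cor. 4.1] [cite: MatarNekovar2019, Thm. 0.3 and §0.11] -/
theorem bsdp_iff_missingLowerBoundAt_of_classX12_of_good_odd
    (W : WeierstrassCurve ℚ) [W.IsElliptic] [W.IsGloballyMinimal] (p : ℕ) [Fact p.Prime]
    (hX : ClassX12 W p) (hp2 : p ≠ 2) (hgood : Good W p) : BSDp W p ↔ MissingLowerBoundAt W p :=
  bsdp_iff_missingLowerBoundAt_of_hasCM_rankOne_of_good_odd' hGZ hKo hMN hGZK hmod hnf hFH2 hCM8 hMazur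
    hCassels W p hX.1 hX.2.1 hp2 hgood

end Summit.BirchSwinnertonDyer.Rank1Residual.X12

end
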